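import Mathlib
import Summits.RiemannHypothesis.RiemannHypothesis.Theorems.WeilGroundStateGroundStateSimpleEvenArchAtomsCalc
import Summits.RiemannHypothesis.RiemannHypothesis.Theorems.WeilGroundStateGroundStateSimpleEvenStubPieceIntegrals
import HarnessLib

/-!
# Crux `GroundStateSimpleEven` (stmt-RiemannHypothesis-1526), line `parity-multiplicity-commutator` v3:
# the certified evaluation — Lorentzian windows and the polynomial piece against three Lorentzians (E-free)

Support file (`--supports stmt-RiemannHypothesis-1526`) of the lead's stub `stub_archimedeanWindows`
(the crux on every archimedean window `0 < a ≤ (log 2)/2`, by the Fourier bathtub for the odd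
sector against the parabola's Rayleigh quotient).
`E`-free helpers for the Lorentzian parts of the evaluation: the polynomial cap against a sum of three Lorentzians on `[0, B]` (linearity + `arch_polyLorentz`), and monotone window bounds for sums of Lorentzians.
Everything is GENERIC in the cap `E : ℝ → ℝ`: its values on the 27 pieces (the Taylor polynomial
`2u²/3 − 2u⁴/15 + 4u⁶/315` on `(0, 7/5]`, certified constants on 24 panels with 7-smooth rational
ends up to `16/5`, `1` on `(16/5, 47/10]`, `2` beyond, `1` at `u ≤ 0`) and its measurability are
SECTION HYPOTHESES, included where used; the cap itself is constructed once, in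
`…ArchCapExists.lean`.  Generated mechanically from the certified table of the lead's folder
(`work/numerics/final_design.py`, `gen2.py`); every constant is re-checked by the kernel.
-/

noncomputable section

open Set MeasureTheory Filter
open scoped Real Topology

namespace Summit.RiemannHypothesis.RiemannHypothesis.Theorems.GroundStateSimpleEven


set_option linter.dupNamespace false in
/-- The polynomial cap against THREE Lorentzians on `[0, B]`, in closed form. [folklore] -/
theorem arch_poly_threeLorentz {A₁ r₁ C₁ A₂ r₂ C₂ A₃ r₃ C₃ B : ℝ}
    (h₁ : 0 < r₁) (e₁ : r₁ ^ 2 = A₁) (h₂ : 0 < r₂) (e₂ : r₂ ^ 2 = A₂) (h₃ : 0 < r₃) (e₃ : r₃ ^ 2 = A₃)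
    (hB : 0 ≤ B) :
    ∫ u in (0 : ℝ)..B, (2 / 3 * u ^ 2 - 2 / 15 * u ^ 4 + 4 / 315 * u ^ 6) * (C₁ / (A₁ + u ^ 2) + C₂ / (A₂ + u ^ 2) + C₃ / (A₃ + u ^ 2)) =
      C₁ * (2 / 3 * (B - r₁ * Real.arctan (B / r₁)) - 2 / 15 * (B ^ 3 / 3 - A₁ * B + A₁ * r₁ * Real.arctan (B / r₁)) + 4 / 315 * (B ^ 5 / 5 - A₁ * B ^ 3 / 3 + A₁ ^ 2 * B - A₁ ^ 2 * r₁ * Real.arctan (B / r₁))) +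
      C₂ * (2 / 3 * (B - r₂ * Real.arctan (B / r₂)) - 2 / 15 * (B ^ 3 / 3 - A₂ * B + A₂ * r₂ * Real.arctan (B / r₂)) + 4 / 315 * (B ^ 5 / 5 - A₂ * B ^ 3 / 3 + A₂ ^ 2 * B - A₂ ^ 2 * r₂ * Real.arctan (B / r₂))) +
      C₃ * (2 / 3 * (B - r₃ * Real.arctan (B / r₃)) - 2 / 15 * (B ^ 3 / 3 - A₃ * B + A₃ * r₃ * Real.arctan (B / r₃)) + 4 / 315 * (B ^ 5 / 5 - A₃ * B ^ 3 / 3 + A₃ ^ 2 * B - A₃ ^ 2 * r₃ * Real.arctan (B / r₃))) := by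
  have hA₁ : 0 < A₁ := by rw [← e₁]; positivity
  have hA₂ : 0 < A₂ := by rw [← e₂]; positivity
  have hA₃ : 0 < A₃ := by rw [← e₃]; positivity
  have hc : ∀ {A C : ℝ}, 0 < A → Continuous (fun u : ℝ ↦ (2 / 3 * u ^ 2 - 2 / 15 * u ^ 4 + 4 / 315 * u ^ 6) * (C / (A + u ^ 2))) :=
    fun {A C} hA ↦ Continuous.mul (by fun_prop)
      (Continuous.div continuous_const (by fun_prop) (fun u ↦ by positivity))
  have hi : ∀ {A C : ℝ}, 0 < A →
      IntervalIntegrable (fun u : ℝ ↦ (2 / 3 * u ^ 2 - 2 / 15 * u ^ 4 + 4 / 315 * u ^ 6) * (C / (A + u ^ 2))) volume 0 B :=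
    fun {A C} hA ↦ (hc hA).intervalIntegrable 0 B
  have e : (fun u : ℝ ↦ (2 / 3 * u ^ 2 - 2 / 15 * u ^ 4 + 4 / 315 * u ^ 6) * (C₁ / (A₁ + u ^ 2) + C₂ / (A₂ + u ^ 2) + C₃ / (A₃ + u ^ 2))) =
      fun u : ℝ ↦ (2 / 3 * u ^ 2 - 2 / 15 * u ^ 4 + 4 / 315 * u ^ 6) * (C₁ / (A₁ + u ^ 2)) + (2 / 3 * u ^ 2 - 2 / 15 * u ^ 4 + 4 / 315 * u ^ 6) * (C₂ / (A₂ + u ^ 2))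
        + (2 / 3 * u ^ 2 - 2 / 15 * u ^ 4 + 4 / 315 * u ^ 6) * (C₃ / (A₃ + u ^ 2)) := by
    funext u; ring
  rw [e, intervalIntegral.integral_add ((hi hA₁).add (hi hA₂)) (hi hA₃),
    intervalIntegral.integral_add (hi hA₁) (hi hA₂),
    arch_polyLorentz h₁ e₁ hB, arch_polyLorentz h₂ e₂ hB, arch_polyLorentz h₃ e₃ hB]

set_option linter.dupNamespace false in
/-- Window bound for three Lorentzians (each decreasing in `u ≥ 0`): the integral over `[a, b]` is at
most the length times the value at the left end. [folklore] -/
theorem arch_threeLorentz_window_le {A₁ C₁ A₂ C₂ A₃ C₃ a b : ℝ} (hA₁ : 0 < A₁) (hC₁ : 0 ≤ C₁)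
    (hA₂ : 0 < A₂) (hC₂ : 0 ≤ C₂) (hA₃ : 0 < A₃) (hC₃ : 0 ≤ C₃) (ha : 0 ≤ a) (hab : a ≤ b) :
    ∫ u in a..b, (C₁ / (A₁ + u ^ 2) + C₂ / (A₂ + u ^ 2) + C₃ / (A₃ + u ^ 2)) ≤
      (b - a) * (C₁ / (A₁ + a ^ 2) + C₂ / (A₂ + a ^ 2) + C₃ / (A₃ + a ^ 2)) := by
  obtain ⟨-, -, -, -, hPI5⟩ := Summit.RiemannHypothesis.RiemannHypothesis.Theorems.stub_pieceIntegrals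
  have i : ∀ {A C : ℝ}, 0 < A → IntervalIntegrable (fun u : ℝ ↦ C / (A + u ^ 2)) volume a b :=
    fun {A C} hA ↦ (Continuous.div continuous_const (by fun_prop)
      (fun u ↦ by positivity)).intervalIntegrable a b
  rw [intervalIntegral.integral_add ((i hA₁).add (i hA₂)) (i hA₃),
    intervalIntegral.integral_add (i hA₁) (i hA₂)]
  have b1 := (hPI5 a b C₁ A₁ ha hab hA₁ hC₁).1
  have b2 := (hPI5 a b C₂ A₂ ha hab hA₂ hC₂).1
  have b3 := (hPI5 a b C₃ A₃ ha hab hA₃ hC₃).1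
  nlinarith

set_option linter.dupNamespace false in
/-- Window bound for one Lorentzian from below: length times the value at the right end. [folklore] -/
theorem arch_oneLorentz_window_ge {A C a b : ℝ} (hA : 0 < A) (hC : 0 ≤ C) (ha : 0 ≤ a) (hab : a ≤ b) :
    (b - a) * (C / (A + b ^ 2)) ≤ ∫ u in a..b, C / (A + u ^ 2) := by
  obtain ⟨-, -, -, -, hPI5⟩ := Summit.RiemannHypothesis.RiemannHypothesis.Theorems.stub_pieceIntegrals
  exact (hPI5 a b C A ha hab hA hC).2


end Summit.RiemannHypothesis.RiemannHypothesis.Theorems.GroundStateSimpleEven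

namespace Summit.RiemannHypothesis.RiemannHypothesis.Theorems

set_option linter.dupNamespace false in
/-- **Registered sub-goal**: monotone window bounds for sums of Lorentzians (from `stub_pieceIntegrals` (v)). [folklore] -/
theorem stub_archLorentzWindows :
    (∀ A₁ C₁ A₂ C₂ A₃ C₃ a b : ℝ, 0 < A₁ → 0 ≤ C₁ → 0 < A₂ → 0 ≤ C₂ → 0 < A₃ → 0 ≤ C₃ →
        0 ≤ a → a ≤ b →
        ∫ u in a..b, (C₁ / (A₁ + u ^ 2) + C₂ / (A₂ + u ^ 2) + C₃ / (A₃ + u ^ 2)) ≤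
          (b - a) * (C₁ / (A₁ + a ^ 2) + C₂ / (A₂ + a ^ 2) + C₃ / (A₃ + a ^ 2))) ∧
      (∀ A C a b : ℝ, 0 < A → 0 ≤ C → 0 ≤ a → a ≤ b →
        (b - a) * (C / (A + b ^ 2)) ≤ ∫ u in a..b, C / (A + u ^ 2)) := by
  exact ⟨fun _ _ _ _ _ _ _ _ hA₁ hC₁ hA₂ hC₂ hA₃ hC₃ ha hab ↦
      GroundStateSimpleEven.arch_threeLorentz_window_le hA₁ hC₁ hA₂ hC₂ hA₃ hC₃ ha hab,
    fun _ _ _ _ hA hC ha hab ↦ GroundStateSimpleEven.arch_oneLorentz_window_ge hA hC ha hab⟩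

end Summit.RiemannHypothesis.RiemannHypothesis.Theorems
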